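import Literature.AlgebraicGeometry.ComplexMultiplication.CyclotomicFermatCMTypesTheoremTwoFactorCount
import HarnessLib

/-!
# Koblitz–Rohrlich THEOREM 1 (ii) FOR THE SIMPLE FACTORS of the Jacobian of the Fermat curve: at every level `N` prime
# to `6`, the simple factors `B_τ`, `B_{τ′}` (`A_τ ∼ B_τ^h`) are isogenous iff `{r′, s′, t′} = {ur, us, ut}` for a unit `u`

Layer `Literature/AlgebraicGeometry/ComplexMultiplication`; §1 in namespace `…ComplexMultiplication` (any CM field Galois over
`ℚ`), §§2–5 in `…ComplexMultiplication.CyclotomicFermatCMType`.  Sequel of `CyclotomicCMTypeIsogenyClasses` (gen 14: «the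
simple factors of isogenous abelian varieties are isogenous» `isIsogenous_of_isIsogeny_fan_of_isSimple`; Milne Prop. 3.13 on the
simple factors `exists_ringEquiv_cmTypeMap_eq_of_isIsogeny`; `A ∼ A′ ⟺ IsAutTransform Φ Φ′` for Galois CM fields), of
`CyclotomicFermatCMTypesTheoremOneEveryLevel` (gen 40: THEOREM 1 (ii) ON THE VARIETIES `A_τ` — `A_τ ∼ A_{τ′}` iff
`{r′,s′,t′} = {ur,us,ut}` — for all admissible triples at every level prime to `6`) and of `CyclotomicFermatCMTypesTheoremTwoFactorCount`
(gen 41: `A_τ ∼ B^h`, `B` simple, `h = |W_τ| ≤ 3`).  Those files decide isogeny of the FULL factors `A_τ` (K–R's lattices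
`L_{r,s,t}`); the paper's title objects — the SIMPLE factors `B_τ` of `J(F_N)` — are reached here: `B_τ ∼ B_{τ′} ⟺ A_τ ∼ A_{τ′}`.
THEOREMS ONLY (no definition, no named fact, no `sorry`; one kernel `decide` over `ℤ/91` in §5).

THE SOURCE.  N. Koblitz, D. Rohrlich, *Simple factors in the Jacobian of a Fermat curve*, Canad. J. Math. **30** (1978) 1183–1205
(held `paper:koblitz1978-simple-factors-jacobian-fermat-curve`, pp. 1183–1186 read first-hand).  P. 1183: "The purpose of this paper
is to determine when two factors in this product are isogenous over `ℂ`, and whether they are absolutely simple."  P. 1184: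
"Suppose `W_{r,s} ≠ {1}`.  Then `L_{r,s}` is isogenous to a product of `|W_{r,s}|` isomorphic simple factors … On the other hand,
suppose `L_{r,s}` and `L_{r′,s′}` are isogenous.  Then the CM-types of their simple factors must be the same up to an automorphism
of the field of complex multiplication, so that `hH_{r,s} = H_{r′,s′}` for some `h` in `(ℤ/Nℤ)*`."  P. 1185: "THEOREM 1.  Suppose
`N` is prime to `6`.  Then: (i) `H_{r,s,t} = H_{r′,s′,t′}` if and only if `{r, s, t} ∼ {r′, s′, t′}`.  (ii) The only isogenies
between the lattices `L_{r,s,t}` are the obvious equalities.  It is clear that (ii) follows from (i)."  The printed argument of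
p. 1184 passes THROUGH the simple factors (Shimura–Taniyama [7]: isogenous simple CM abelian varieties have CM pairs related by an
isomorphism); this file records that step as an equivalence and reads Theorem 1 (ii) on the simple factors.

## What is proved

* §1 (ANY CM field `L` Galois over `ℚ`, realisations `A` of `(L; Φ)`, `A′` of `(L; Φ′)`, and ANY decompositions `A → P ≅ B^h`,
  `A′ → P′ ≅ B′^{h′}` — isogenies onto limit fans, `B`, `B′` SIMPLE; `h, h′ > 0` is automatic):
  `dim_eq_card_mul_dim_of_isIsogeny_fan` (`dim A = h·dim B`), `dim_pos_of_isIsogeny_fan`, `card_pos_of_isIsogeny_fan`;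
  `isAutTransform_of_ringEquiv_inducedCMType` (an isomorphism of inducing sub-pairs `(K₁; Φ₁) ≅ (K₁′; Φ₁′)` extends to an
  automorphism of `L` transforming `Φ` into `Φ′` — `AlgHom.liftNormal`, the step inlined in gen 14's
  `isAutTransform_of_isIsogenous_of_isGalois`); **`isIsogenous_of_isIsogenous_simpleFactors`** (`B ∼ B′ ⟹ A ∼ A′`: the CM simple
  factors `B₀ ∼ B`, `B₀′ ∼ B′` by Poincaré uniqueness, Milne Prop. 3.13 on `B₀ ∼ B₀′`, lift, Shimura §6.1 Cor.);
  **`isIsogenous_simpleFactors_iff`** (`B ∼ B′ ⟺ A ∼ A′`); **`eq_and_isIsogenous_of_isIsogeny_fan`** (two decompositions of ONE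
  `A`: `h = h′` and `B ∼ B′` — the number of simple factors is well defined).
* §2 (`L = ℚ(ζ_N)`, any `N ≥ 3`): **`isIsogenous_simpleFactors_iff_exists_unit_translate`** (`B ∼ B′` iff `S_{Φ′}` is a unit
  translate of `S_Φ` — «so that `hH_{r,s} = H_{r′,s′}`»); `card_eq_card_stabilizerResidues_of_isIsogeny_fan` (ANY decomposition
  `A ∼ B^h` with `B` simple has `h = |W|`, the residue stabiliser count of gen 14).
* §3 THEOREM 1 (ii) FOR THE SIMPLE FACTORS, every `N` prime to `6`, ALL admissible triples (non-zero entries summing to `0`):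
  **`isIsogenous_simpleFactors_fermat_iff_coprimeSix`** — `B_τ ∼ B_{τ′} ⟺ ∃ unit u, {r′,s′,t′} = {ur,us,ut}`;
  `not_isIsogenous_simpleFactors_fermat_of_forall` (contrapositive form); at PRIME level
  **`isIsogenous_simpleFactors_fermat_iff_mem_orbit`** (`B_{1,a} ∼ B_{1,a′}` iff `a′ ∈ {a, −1−a, a⁻¹, −(1+a)a⁻¹, (−1−a)⁻¹, −a(1+a)⁻¹}`).
* §4 with THEOREM 2 (gen 41's count): **`card_le_three_of_isIsogeny_fan_fermat_coprimeSix`** — at `N` prime to `6`, for an admissible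
  PRIMITIVE triple, EVERY decomposition `A_τ ∼ B^h` (`B` simple) has `1 ≤ h ≤ 3` and `2h·dim B = φ(N)`.
* §5 `N = 91`: the first-family triples `{1, 9, 81}` and `{1, 16, 74}` (two classes of cube roots of unity modulo `7·13`) are NOT
  unit multiples of each other (`decide`), so their simple factors — both `12`-dimensional, both occurring as cubes (gen 41
  `exists_realisation_isIsogeny_cube_ninetyOne`) — are NOT isogenous: **`not_isIsogenous_simpleFactors_ninetyOne`**.

## Honest column / NOT here

* As everywhere in this series the objects are abelian varieties REALISING the CM types `Φ_{H_τ}` on `H¹` (`IsCMTypeRealisation`) and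
  decompositions are isogenies onto limit fans `B^h`; the Jacobian `J(F_N)`, its factors `A_τ = L_{r,s,t}` as abelian sub- or quotient varieties
  and the multiplicities with which a given simple `B` occurs in `J(F_N)` (a sum over classes of triples) are NOT constructed — the
  tree's record of the factors inside the Jacobian is the FACT `HodgeTheory.Aoki2002_fermatFactor_cmTypeOf`, not used here.
* "Simple" allows dimension `0` in the tree's `IsSimple`; positivity of `dim B` and of `h` is derived from `dim A > 0` (an isogeny
  onto `B^h` with `h·dim B = dim A`).
* Levels not prime to `6` (Theorems 3–4) are the siblings' (`…ThreePowerLevelIsogenies`, `…TwoPowerLevelIsogenies`, on the full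
  factors); the simple-factor reading there is the same §1 lemma and is not spelled out.

## References

* [KoblitzRohrlich1978] N. Koblitz, D. Rohrlich, Canad. J. Math. 30 (1978) 1183–1205: §1 pp. 1183–1184, Theorem 1 (p. 1185), Theorem 2
  (pp. 1185–1186).
* [MumfordAV1970] D. Mumford, *Abelian Varieties*, §19 Thm. 1, Cor. 1–2 (pp. 173–174) (through `CyclotomicCMTypeIsogenyClasses` §6).
* [MilneCM2006] J. S. Milne, *Complex Multiplication* (course notes), Ch. I Prop. 3.13 and its proof (through
  `SimpleCMAbelianVarietyIsogenyClasses`).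
* [Shimura1998] G. Shimura, *Abelian Varieties with Complex Multiplication and Modular Functions* (1998), §6.1 Corollary, §6.2 Thm. 3,
  §8.2 Prop. 26, §8.4 Example (1).

## Provenance

Cell `pub-hodgecm2` (COR-CM), literature seat `lit-deligne-3` gen 41 (claim KR78-SIMPLE-FACTORS; count-neutral, own lane).  HC_CM is NOT
proved and nothing here bears on it.
-/

noncomputable section

open NumberField

namespace Literature.AlgebraicGeometry.ComplexMultiplication

open CategoryTheory CategoryTheory.Limits
open Literature.AlgebraicGeometry.Motives (CMType AbelianVariety)
open Literature.AlgebraicGeometry.Motives.AbelianVariety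
open Literature.NumberTheory.ComplexMultiplication
open Literature.AlgebraicGeometry.HodgeTheory
open Literature.AlgebraicGeometry.Pohlmann1968 Literature.AlgebraicGeometry.Pohlmann1968.Cyclotomic
open CyclotomicCMTypeResidueSets (IsCMResidueSet IsAutTransform unitResidues residueSet residueSet_cmTypeOfResidues)

/-! ## §1 Simple factors of realisations of CM types of a Galois CM field: `B ∼ B′ ⟺ A ∼ A′` -/

section General

variable {L : Type} [Field L] [NumberField L] {Φ Φ' : CMType L} {A A' : AbelianVariety ℂ}
  {ι : 𝓞 L →+* End A} {θ : L →+* Module.End ℂ (complexBetti A.X 1)}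
  {ι' : 𝓞 L →+* End A'} {θ' : L →+* Module.End ℂ (complexBetti A'.X 1)}

omit [NumberField L] in
/-- **`dim A = h · dim B`** for an isogeny `A → P` onto a product `P ≅ B^h` (limit fan): `⊕_j π_j^* : H¹(B; ℚ)^h → H¹(P; ℚ)` is
bijective (tree `product_bettiMap_bijective_holds`), `b₁ = 2 dim`, and `dim A = dim P`. [cite: Shimura1998, §6.2 Theorem 3 (proof, p. 44: «the
direct product of `h` copies», `n = hm`)] [cite: MumfordAV1970, §19 Thm. 1 (p. 173)] -/
theorem dim_eq_card_mul_dim_of_isIsogeny_fan {A P B : AbelianVariety ℂ} {h : ℕ} {π : Fin h → (P ⟶ B)}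
    (hP : Nonempty (IsLimit (Fan.mk P π))) {g : A ⟶ P} (hg : IsIsogeny g) : A.dim = h * B.dim := by
  have hprod := product_bettiMap_bijective_holds h P B π hP
  have e := (LinearEquiv.ofBijective _ hprod).finrank_eq
  rw [Module.finrank_pi_fintype, Finset.sum_const, Finset.card_univ, Fintype.card_fin, smul_eq_mul,
    HodgeTheory.finrank_bettiCohomology_one, HodgeTheory.finrank_bettiCohomology_one, ← dim_eq_of_isIsogeny hg] at e
  have e' : 2 * (h * B.dim) = 2 * A.dim := by rw [← e]; ring
  exact (Nat.eq_of_mul_eq_mul_left (by norm_num) e').symm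

omit [NumberField L] in
/-- A simple factor of a positive-dimensional variety is positive-dimensional. [cite: MumfordAV1970, §19 Thm. 1 (p. 173)] -/
theorem dim_pos_of_isIsogeny_fan {A P B : AbelianVariety ℂ} {h : ℕ} {π : Fin h → (P ⟶ B)}
    (hP : Nonempty (IsLimit (Fan.mk P π))) {g : A ⟶ P} (hg : IsIsogeny g) (hA : 0 < A.dim) : 0 < B.dim := by
  have e := dim_eq_card_mul_dim_of_isIsogeny_fan hP hg
  rcases Nat.eq_zero_or_pos B.dim with h0 | h0
  · rw [h0, mul_zero] at e
    omega
  · exact h0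

omit [NumberField L] in
/-- An isogeny onto `B^h` from a positive-dimensional variety has `h > 0`. [cite: MumfordAV1970, §19 Thm. 1 (p. 173)] -/
theorem card_pos_of_isIsogeny_fan {A P B : AbelianVariety ℂ} {h : ℕ} {π : Fin h → (P ⟶ B)}
    (hP : Nonempty (IsLimit (Fan.mk P π))) {g : A ⟶ P} (hg : IsIsogeny g) (hA : 0 < A.dim) : 0 < h := by
  have e := dim_eq_card_mul_dim_of_isIsogeny_fan hP hg
  rcases Nat.eq_zero_or_pos h with h0 | h0
  · rw [h0, zero_mul] at e
    omega
  · exact h0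

/-- **An isomorphism of inducing sub-pairs extends to an automorphism transforming the induced types** (`L/ℚ` Galois): if
`Φ = Φ₁^L`, `Φ′ = Φ₁′^L` and `e : K₁ ≅ K₁′` carries `Φ₁` to `Φ₁′`, then `Φ′` is the transform of `Φ` by some `γ ∈ Aut(L)` (`e` extends
to `γ` by `AlgHom.liftNormal`; `Φ′ = Ind Φ₁′ = Ind (Φ₁ ∘ e⁻¹) = Φ ∘ γ⁻¹`) — the step inlined in the sibling's
`isAutTransform_of_isIsogenous_of_isGalois`. [cite: MilneCM2006, Ch. I Prop. 3.13 and its proof (p. 30)] [cite: KoblitzRohrlich1978, §1 p. 1184] -/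
theorem isAutTransform_of_ringEquiv_inducedCMType [IsGalois ℚ L] {K₁ K₁' : IntermediateField ℚ L} {Φ₁ : CMType K₁}
    {Φ₁' : CMType K₁'} (hind : inducedCMType (algebraMap K₁ L) Φ₁ = Φ) (hind' : inducedCMType (algebraMap K₁' L) Φ₁' = Φ')
    (e : K₁ ≃+* K₁') (he : Literature.NumberTheory.Automorphic.PicardCM.CMCode.cmTypeMap e Φ₁ = Φ₁') : IsAutTransform Φ Φ' := by
  -- extend `K₁ —e→ K₁' ⊂ L` to an automorphism `γ` of the normal extension `L/ℚ`
  let φ : K₁ →ₐ[ℚ] L :=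
    { (algebraMap K₁' L).comp e.toRingHom with commutes' := fun q => by simp }
  let ψ : L →ₐ[ℚ] L := φ.liftNormal L
  let γ : L ≃ₐ[ℚ] L := AlgEquiv.ofBijective ψ (Algebra.IsAlgebraic.algHom_bijective ψ)
  have hγ : (γ : L →+* L).comp (algebraMap K₁ L) = (algebraMap K₁' L).comp e.toRingHom := by
    ext x
    show ψ (algebraMap K₁ L x) = algebraMap K₁' L (e x)
    rw [AlgHom.liftNormal_commutes]
    rfl
  refine ⟨γ, fun σ => ?_⟩
  have key : (σ.comp (γ : L →+* L)).comp (algebraMap K₁ L) = (σ.comp (algebraMap K₁' L)).comp e.toRingHom := by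
    rw [RingHom.comp_assoc, hγ, ← RingHom.comp_assoc]
  rw [← hind, ← hind', mem_inducedCMType_iff, mem_inducedCMType_iff, key, ← he,
    Literature.NumberTheory.Automorphic.PicardCM.CMCode.mem_cmTypeMap_iff]

/-- **Isogenous simple factors ⟹ isogenous varieties** (`L` a CM field Galois over `ℚ`; `(A, ι, θ)` of type `(L; Φ)`, `(A′, ι′, θ′)` of
type `(L; Φ′)`; `A → P ≅ B^h` and `A′ → P′ ≅ B′^{h′}` ANY isogenies onto powers of SIMPLE `B`, `B′`).  PROOF (K–R p. 1184
«the CM-types of their simple factors must be the same up to an automorphism of the field of complex multiplication»): the CM simple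
factors `B₀` of `A` and `B₀′` of `A′` (realising the primitive sub-pairs, Milne's proof of Prop. 3.13) are isogenous to `B`, `B′`
(Poincaré uniqueness, tree `isIsogenous_of_isIsogeny_fan_of_isSimple`), so `B₀ ∼ B₀′`; hence `(K₁; Φ₁) ≅ (K₁′; Φ₁′)` (Prop. 3.13 on
simple varieties, tree `exists_ringEquiv_cmTypeMap_eq_of_isIsogeny`), `Φ′ = Φ ∘ γ⁻¹`, and `A ∼ A′` (Shimura §6.1 Cor., tree
`isIsogenous_of_isAutTransform`). [cite: KoblitzRohrlich1978, §1 p. 1184] [cite: MilneCM2006, Ch. I Prop. 3.13 (proof, p. 30)]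
[cite: MumfordAV1970, §19 Thm. 1, Cor. 1–2 (pp. 173–174)] [cite: Shimura1998, §6.1 Corollary] -/
theorem isIsogenous_of_isIsogenous_simpleFactors [IsCMField L] [IsGalois ℚ L]
    (hA : IsCMTypeRealisation Φ A ι θ) (hA' : IsCMTypeRealisation Φ' A' ι' θ')
    {P P' B B' : AbelianVariety ℂ} {h h' : ℕ} {π : Fin h → (P ⟶ B)} (hP : IsLimit (Fan.mk P π))
    {π' : Fin h' → (P' ⟶ B')} (hP' : IsLimit (Fan.mk P' π')) {g : A ⟶ P} (hg : IsIsogeny g) {g' : A' ⟶ P'}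
    (hg' : IsIsogeny g') (hsB : B.IsSimple) (hsB' : B'.IsSimple) (hBB' : IsIsogenous B B') :
    IsIsogenous A A' := by
  have hh' : 0 < h' := card_pos_of_isIsogeny_fan ⟨hP'⟩ hg' hA'.dim_pos
  obtain ⟨K₁, Φ₁, hCM₁, hind, -, B₀, ιB₀, θB₀, hB₀, hsB₀, -, h₀, P₀, π₀, ⟨hP₀⟩, hh₀, g₀, hg₀, -⟩ :=
    exists_isIsogeny_power_simple_of_isCMTypeRealisation hA
  obtain ⟨K₁', Φ₁', hCM₁', hind', -, B₀', ιB₀', θB₀', hB₀', hsB₀', -, h₀', P₀', π₀', ⟨hP₀'⟩, hh₀', g₀', hg₀', -⟩ :=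
    exists_isIsogeny_power_simple_of_isCMTypeRealisation hA'
  have hpos : 0 < h₀ := by
    refine Nat.pos_of_ne_zero ?_
    rintro rfl
    rw [zero_mul] at hh₀
    exact (Module.finrank_pos (R := ℚ) (M := L)).ne hh₀
  -- `B₀ ∼ B` and `B' ∼ B₀'`
  have h1 : IsIsogenous B₀ B :=
    isIsogenous_of_isIsogeny_fan_of_isSimple hP₀ hP hg₀ (isIsogeny_id A) hg hpos hsB₀ hB₀.dim_pos hsB
  have hBdim : 0 < B'.dim := by
    obtain ⟨u, hu⟩ := hBB'
    rw [← dim_eq_of_isIsogeny hu]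
    exact dim_pos_of_isIsogeny_fan ⟨hP⟩ hg hA.dim_pos
  have h2 : IsIsogenous B' B₀' :=
    isIsogenous_of_isIsogeny_fan_of_isSimple hP' hP₀' hg' (isIsogeny_id A') hg₀' hh' hsB' hBdim hsB₀'
  obtain ⟨u, hu⟩ := (h1.trans hBB').trans h2
  haveI := hCM₁
  haveI := hCM₁'
  obtain ⟨e, he⟩ := exists_ringEquiv_cmTypeMap_eq_of_isIsogeny hB₀ hB₀' hsB₀ hu
  exact isIsogenous_of_isAutTransform (isAutTransform_of_ringEquiv_inducedCMType hind hind' e he) hA hA'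

/-- **The simple factors are isogenous iff the varieties are** (`L` a CM field Galois over `ℚ`; any decompositions into powers of
simples; ⟸ is Poincaré uniqueness, tree `isIsogenous_of_isIsogeny_fan_of_isSimple`). [cite: KoblitzRohrlich1978, §1 p. 1184]
[cite: MumfordAV1970, §19 Thm. 1, Cor. 1–2 (pp. 173–174)] [cite: MilneCM2006, Ch. I Prop. 3.13] -/
theorem isIsogenous_simpleFactors_iff [IsCMField L] [IsGalois ℚ L]
    (hA : IsCMTypeRealisation Φ A ι θ) (hA' : IsCMTypeRealisation Φ' A' ι' θ')
    {P P' B B' : AbelianVariety ℂ} {h h' : ℕ} {π : Fin h → (P ⟶ B)} (hP : IsLimit (Fan.mk P π))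
    {π' : Fin h' → (P' ⟶ B')} (hP' : IsLimit (Fan.mk P' π')) {g : A ⟶ P} (hg : IsIsogeny g) {g' : A' ⟶ P'}
    (hg' : IsIsogeny g') (hsB : B.IsSimple) (hsB' : B'.IsSimple) :
    IsIsogenous B B' ↔ IsIsogenous A A' := by
  refine ⟨isIsogenous_of_isIsogenous_simpleFactors hA hA' hP hP' hg hg' hsB hsB', fun ⟨f, hf⟩ => ?_⟩
  exact isIsogenous_of_isIsogeny_fan_of_isSimple hP hP' hg hf hg' (card_pos_of_isIsogeny_fan ⟨hP⟩ hg hA.dim_pos) hsB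
    (dim_pos_of_isIsogeny_fan ⟨hP⟩ hg hA.dim_pos) hsB'

omit [NumberField L] in
/-- **The number of simple factors is well defined**: two decompositions `A → P ≅ B^h`, `A → P′ ≅ B′^{h′}` of one positive-dimensional
`A` into powers of SIMPLE varieties have `B ∼ B′` and `h = h′` (Poincaré: `B ∼ B′`; then `h·dim B = dim A = h′·dim B′`
with `dim B = dim B′ > 0`). [cite: MumfordAV1970, §19 Thm. 1, Cor. 1–2 (pp. 173–174: «the `A_i` are uniquely determined up to isogeny»)] -/
theorem eq_and_isIsogenous_of_isIsogeny_fan {A P P' B B' : AbelianVariety ℂ} (hA : 0 < A.dim) {h h' : ℕ}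
    {π : Fin h → (P ⟶ B)} (hP : IsLimit (Fan.mk P π)) {π' : Fin h' → (P' ⟶ B')} (hP' : IsLimit (Fan.mk P' π'))
    {g : A ⟶ P} (hg : IsIsogeny g) {g' : A ⟶ P'} (hg' : IsIsogeny g') (hsB : B.IsSimple) (hsB' : B'.IsSimple) :
    h = h' ∧ IsIsogenous B B' := by
  have hBB' : IsIsogenous B B' :=
    isIsogenous_of_isIsogeny_fan_of_isSimple hP hP' hg (isIsogeny_id A) hg' (card_pos_of_isIsogeny_fan ⟨hP⟩ hg hA) hsB
      (dim_pos_of_isIsogeny_fan ⟨hP⟩ hg hA) hsB'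
  refine ⟨?_, hBB'⟩
  obtain ⟨u, hu⟩ := hBB'
  have e1 := dim_eq_card_mul_dim_of_isIsogeny_fan ⟨hP⟩ hg
  have e2 := dim_eq_card_mul_dim_of_isIsogeny_fan ⟨hP'⟩ hg'
  have hd : B.dim = B'.dim := dim_eq_of_isIsogeny hu
  have hBpos : 0 < B.dim := dim_pos_of_isIsogeny_fan ⟨hP⟩ hg hA
  rw [hd] at e1 hBpos
  exact Nat.eq_of_mul_eq_mul_right hBpos (e1.symm.trans e2)

end General

/-! ## §2 `ℚ(ζ_N)`: the simple factors are isogenous iff the residue sets are unit translates; `h = |W|` for any decomposition -/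

section Cyclotomic

variable {N : ℕ} [NeZero N] {L : Type} [Field L] [NumberField L] [IsCyclotomicExtension {N} ℚ L]
  {Φ Φ' : CMType L} {A A' : AbelianVariety ℂ}
  {ι : 𝓞 L →+* End A} {θ : L →+* Module.End ℂ (complexBetti A.X 1)}
  {ι' : 𝓞 L →+* End A'} {θ' : L →+* Module.End ℂ (complexBetti A'.X 1)}

/-- **K–R p. 1184 on the simple factors, at EVERY level `N`**: for realisations `A` of `(ℚ(ζ_N); Φ)`, `A′` of `(ℚ(ζ_N); Φ′)` and any
decompositions `A ∼ B^h`, `A′ ∼ B′^{h′}` into powers of simples, `B ∼ B′` iff the residue set of `Φ′` is a unit translate of that of `Φ`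
(«the CM-types of their simple factors must be the same up to an automorphism … so that `hH_{r,s} = H_{r′,s′}` for some `h`»).
[cite: KoblitzRohrlich1978, §1 p. 1184] [cite: Shimura1998, §8.4 Example (1)] -/
theorem isIsogenous_simpleFactors_iff_exists_unit_translate [IsCMField L]
    (hA : IsCMTypeRealisation Φ A ι θ) (hA' : IsCMTypeRealisation Φ' A' ι' θ')
    {P P' B B' : AbelianVariety ℂ} {h h' : ℕ} {π : Fin h → (P ⟶ B)} (hP : IsLimit (Fan.mk P π))
    {π' : Fin h' → (P' ⟶ B')} (hP' : IsLimit (Fan.mk P' π')) {g : A ⟶ P} (hg : IsIsogeny g) {g' : A' ⟶ P'}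
    (hg' : IsIsogeny g') (hsB : B.IsSimple) (hsB' : B'.IsSimple) :
    IsIsogenous B B' ↔
      ∃ u ∈ unitResidues N, ∀ c ∈ unitResidues N, (c ∈ residueSet N Φ' ↔ c * u ∈ residueSet N Φ) := by
  haveI : IsGalois ℚ L := IsCyclotomicExtension.isGalois {N} ℚ L
  rw [isIsogenous_simpleFactors_iff hA hA' hP hP' hg hg' hsB hsB', isIsogenous_iff_exists_unit_translate (N := N) hA hA']

/-- **`h = |W|` for ANY decomposition** `A ∼ B^h` (`B` simple) of a realisation of `(ℚ(ζ_N); Φ)`: the number of simple factors is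
the order of the residue stabiliser `W = {t ∈ (ℤ/N)ˣ | S_Φ·t = S_Φ}` («a product of `|W_{r,s}|` isomorphic simple factors»).
[cite: KoblitzRohrlich1978, §1 p. 1184] [cite: MumfordAV1970, §19 Cor. 1–2 (pp. 173–174)] -/
theorem card_eq_card_stabilizerResidues_of_isIsogeny_fan [IsCMField L] (hA : IsCMTypeRealisation Φ A ι θ)
    {P B : AbelianVariety ℂ} {h : ℕ} {π : Fin h → (P ⟶ B)} (hP : IsLimit (Fan.mk P π)) {g : A ⟶ P} (hg : IsIsogeny g)
    (hsB : B.IsSimple) :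
    h = ((unitResidues N).filter fun t =>
      ∀ c ∈ unitResidues N, (c * t ∈ residueSet N Φ ↔ c ∈ residueSet N Φ)).card := by
  obtain ⟨K₁, Φ₁, -, -, -, -, B₀, ιB₀, θB₀, -, hsB₀, -, P₀, π₀, ⟨hP₀⟩, g₀, hg₀, -⟩ :=
    exists_isIsogeny_power_simple_cyclotomic (N := N) hA
  exact (eq_and_isIsogenous_of_isIsogeny_fan hA.dim_pos hP hP₀ hg hg₀ hsB hsB₀).1

end Cyclotomic

namespace CyclotomicFermatCMType

/-! ## §3 THEOREM 1 (ii) for the simple factors of `J(F_N)`, every `N` prime to `6` -/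

section Fermat

variable {N : ℕ} [NeZero N] {L : Type} [Field L] [NumberField L] [IsCyclotomicExtension {N} ℚ L]
  {r s t r' s' t' : ZMod N} {A A' : AbelianVariety ℂ}
  {ι : 𝓞 L →+* End A} {θ : L →+* Module.End ℂ (complexBetti A.X 1)}
  {ι' : 𝓞 L →+* End A'} {θ' : L →+* Module.End ℂ (complexBetti A'.X 1)}

/-- `2 < N` as soon as `N` is prime to `2` and `ℤ/N` has a non-zero element (private copy). [folklore] -/
private theorem two_lt_level_sf (hN2 : Nat.Coprime 2 N) {a : ZMod N} (ha : a ≠ 0) : 2 < N := by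
  have h0 : N ≠ 0 := NeZero.ne N
  have h1 : N ≠ 1 := by
    rintro rfl
    exact ha (Subsingleton.elim a 0)
  have h2 : N ≠ 2 := by
    rintro rfl
    norm_num at hN2
  omega

/-- **KOBLITZ–ROHRLICH THEOREM 1 (ii) FOR THE SIMPLE FACTORS, AT EVERY LEVEL `N` PRIME TO `6`, ALL ADMISSIBLE TRIPLES.**  Let
`τ = (r, s, t)`, `τ′ = (r′, s′, t′)` have non-zero entries summing to `0` modulo `N`, let `A`, `A′` realise the CM types `Φ_{H_τ}`,
`Φ_{H_{τ′}}` of `ℚ(ζ_N)`, and let `A → P ≅ B^h`, `A′ → P′ ≅ B′^{h′}` be ANY isogenies onto powers of SIMPLE abelian varieties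
— the simple factors of K–R's `L_τ`, `L_{τ′}`.  Then **`B ∼ B′` iff `{r′, s′, t′} = {ur, us, ut}` for a unit `u`** ("The only isogenies
… are the obvious equalities", read on the simple factors: §1 + the sibling's Theorem 1 (ii) on the varieties `A_τ`).
[cite: KoblitzRohrlich1978, Theorem 1 (ii) (p. 1185) and §1 p. 1184] [cite: MilneCM2006, Ch. I Prop. 3.13] [cite: MumfordAV1970, §19 Cor. 1–2] -/
theorem isIsogenous_simpleFactors_fermat_iff_coprimeSix (hN2 : Nat.Coprime 2 N) (hN3 : Nat.Coprime 3 N)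
    (hr : r ≠ 0) (hs : s ≠ 0) (ht : t ≠ 0) (hrst : r + s + t = 0) (hr' : r' ≠ 0) (hs' : s' ≠ 0) (ht' : t' ≠ 0)
    (hrst' : r' + s' + t' = 0) (hS : IsCMResidueSet N (fermatCMType N r s t)) (hS' : IsCMResidueSet N (fermatCMType N r' s' t'))
    (hA : IsCMTypeRealisation (cmTypeOfResidues (L := L) (fermatCMType N r s t) hS.cm) A ι θ)
    (hA' : IsCMTypeRealisation (cmTypeOfResidues (L := L) (fermatCMType N r' s' t') hS'.cm) A' ι' θ')
    {P P' B B' : AbelianVariety ℂ} {h h' : ℕ} {π : Fin h → (P ⟶ B)} (hP : IsLimit (Fan.mk P π))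
    {π' : Fin h' → (P' ⟶ B')} (hP' : IsLimit (Fan.mk P' π')) {g : A ⟶ P} (hg : IsIsogeny g) {g' : A' ⟶ P'}
    (hg' : IsIsogeny g') (hsB : B.IsSimple) (hsB' : B'.IsSimple) :
    IsIsogenous B B' ↔ ∃ u : ZMod N, IsUnit u ∧ ({r', s', t'} : Multiset (ZMod N)) = {u * r, u * s, u * t} := by
  haveI : IsCMField L := IsCyclotomicExtension.Rat.isCMField L (S := {N}) ⟨N, rfl, two_lt_level_sf hN2 hr⟩
  haveI : IsGalois ℚ L := IsCyclotomicExtension.isGalois {N} ℚ L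
  rw [isIsogenous_simpleFactors_iff hA hA' hP hP' hg hg' hsB hsB',
    isIsogenous_iff_exists_unit_multiset_eq_of_admissible hN2 hN3 hr hs ht hrst hr' hs' ht' hrst' hS hS' hA hA']

/-- **Contrapositive: inequivalent triples give NON-ISOGENOUS simple factors** at every `N` prime to `6` ("determine when two factors … are
isogenous"). [cite: KoblitzRohrlich1978, Theorem 1 (ii) (p. 1185)] -/
theorem not_isIsogenous_simpleFactors_fermat_of_forall (hN2 : Nat.Coprime 2 N) (hN3 : Nat.Coprime 3 N)
    (hr : r ≠ 0) (hs : s ≠ 0) (ht : t ≠ 0) (hrst : r + s + t = 0) (hr' : r' ≠ 0) (hs' : s' ≠ 0) (ht' : t' ≠ 0)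
    (hrst' : r' + s' + t' = 0) (hS : IsCMResidueSet N (fermatCMType N r s t)) (hS' : IsCMResidueSet N (fermatCMType N r' s' t'))
    (hA : IsCMTypeRealisation (cmTypeOfResidues (L := L) (fermatCMType N r s t) hS.cm) A ι θ)
    (hA' : IsCMTypeRealisation (cmTypeOfResidues (L := L) (fermatCMType N r' s' t') hS'.cm) A' ι' θ')
    {P P' B B' : AbelianVariety ℂ} {h h' : ℕ} {π : Fin h → (P ⟶ B)} (hP : IsLimit (Fan.mk P π))
    {π' : Fin h' → (P' ⟶ B')} (hP' : IsLimit (Fan.mk P' π')) {g : A ⟶ P} (hg : IsIsogeny g) {g' : A' ⟶ P'}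
    (hg' : IsIsogeny g') (hsB : B.IsSimple) (hsB' : B'.IsSimple)
    (hno : ∀ u : ZMod N, ({r', s', t'} : Multiset (ZMod N)) ≠ {u * r, u * s, u * t}) : ¬IsIsogenous B B' := fun hBB' => by
  obtain ⟨u, -, hu⟩ := (isIsogenous_simpleFactors_fermat_iff_coprimeSix hN2 hN3 hr hs ht hrst hr' hs' ht' hrst' hS hS' hA hA' hP hP'
    hg hg' hsB hsB').1 hBB'
  exact hno u hu

end Fermat

/-! ### Prime level: the orbit of `a` -/

section Prime

variable {p : ℕ} [hp : Fact p.Prime] {L : Type} [Field L] [NumberField L] [IsCyclotomicExtension {p} ℚ L]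
  {a a' : ZMod p}
  {hS : ∀ c : ZMod p, c.val.Coprime p → (c ∈ fermatCMType p 1 a (-1 - a) ↔ -c ∉ fermatCMType p 1 a (-1 - a))}
  {hS' : ∀ c : ZMod p, c.val.Coprime p →
    (c ∈ fermatCMType p 1 a' (-1 - a') ↔ -c ∉ fermatCMType p 1 a' (-1 - a'))}
  {A : AbelianVariety ℂ} {ι : 𝓞 L →+* End A} {θ : L →+* Module.End ℂ (complexBetti A.X 1)}
  {A' : AbelianVariety ℂ} {ι' : 𝓞 L →+* End A'} {θ' : L →+* Module.End ℂ (complexBetti A'.X 1)}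

/-- `p ≠ 2` when `a ≠ 0` and `1 + a ≠ 0` modulo `p` (private copy of the sibling's). [folklore] -/
private theorem ne_two_of_ne_zero_of_one_add_ne_zero_sf (ha : a ≠ 0) (ha1 : 1 + a ≠ 0) : p ≠ 2 := by
  rintro rfl
  have h1 : a = 1 := by simpa using ZMod.pow_card_sub_one_eq_one ha
  have h2 : (2 : ZMod 2) = 0 := by exact_mod_cast ZMod.natCast_self 2
  exact ha1 (by rw [h1, one_add_one_eq_two, h2])

/-- **PRIME LEVEL: the simple factors `B_{1,a}`, `B_{1,a′}` of `J(x^p + y^p = 1)` are isogenous iff `a′` lies in the orbit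
`{a, −1−a, a⁻¹, −(1+a)a⁻¹, (−1−a)⁻¹, −a(1+a)⁻¹}` of `a`** (any decompositions `A_{S_a} ∼ B^h`, `A_{S_{a′}} ∼ B′^{h′}` into powers of
simples; the sibling's `isIsogenous_fermat_iff_mem_orbit` on the full factors + §1).  For `a³ ≡ 1 ≢ a` this concerns the simple factor of
the cube `A_{S_a} ∼ B³`. [cite: KoblitzRohrlich1978, Theorem 1 (ii) (p. 1185) and §1 p. 1184] [cite: MilneCM2006, Ch. I Prop. 3.13] -/
theorem isIsogenous_simpleFactors_fermat_iff_mem_orbit (ha : a ≠ 0) (ha1 : 1 + a ≠ 0) (ha' : a' ≠ 0) (ha1' : 1 + a' ≠ 0)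
    (hA : IsCMTypeRealisation (cmTypeOfResidues (L := L) (fermatCMType p 1 a (-1 - a)) hS) A ι θ)
    (hA' : IsCMTypeRealisation (cmTypeOfResidues (L := L) (fermatCMType p 1 a' (-1 - a')) hS') A' ι' θ')
    {P P' B B' : AbelianVariety ℂ} {h h' : ℕ} {π : Fin h → (P ⟶ B)} (hP : IsLimit (Fan.mk P π))
    {π' : Fin h' → (P' ⟶ B')} (hP' : IsLimit (Fan.mk P' π')) {g : A ⟶ P} (hg : IsIsogeny g) {g' : A' ⟶ P'}
    (hg' : IsIsogeny g') (hsB : B.IsSimple) (hsB' : B'.IsSimple) :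
    IsIsogenous B B' ↔
      (a' = a ∨ a' = -1 - a ∨ a' = a⁻¹ ∨ a' = a⁻¹ * (-1 - a) ∨ a' = (-1 - a)⁻¹ ∨ a' = (-1 - a)⁻¹ * a) := by
  haveI : IsCMField L := IsCyclotomicExtension.Rat.isCMField L (S := {p})
    ⟨p, rfl, lt_of_le_of_ne hp.out.two_le (ne_two_of_ne_zero_of_one_add_ne_zero_sf ha ha1).symm⟩
  haveI : IsGalois ℚ L := IsCyclotomicExtension.isGalois {p} ℚ L
  rw [isIsogenous_simpleFactors_iff hA hA' hP hP' hg hg' hsB hsB', isIsogenous_fermat_iff_mem_orbit ha ha1 ha' ha1' hA hA']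

end Prime

/-! ## §4 With THEOREM 2: every decomposition of `A_τ` at a level prime to `6` has at most three simple factors -/

section Count

variable {N : ℕ} [NeZero N] {L : Type} [Field L] [NumberField L] [IsCyclotomicExtension {N} ℚ L]
  {r s t : ZMod N}
  {hS : ∀ c : ZMod N, c.val.Coprime N → (c ∈ fermatCMType N r s t ↔ -c ∉ fermatCMType N r s t)}
  {A : AbelianVariety ℂ} {ι : 𝓞 L →+* End A} {θ : L →+* Module.End ℂ (complexBetti A.X 1)}

/-- **At most three simple factors, for ANY decomposition**: at `N` prime to `6`, for an admissible PRIMITIVE triple `τ`, every isogeny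
`A_τ → P ≅ B^h` onto a power of a SIMPLE `B` has `1 ≤ h ≤ 3` and `2h · dim B = φ(N)` (`h = |W_τ|`, gen 41's bound).
[cite: KoblitzRohrlich1978, §1 (p. 1184) and Theorem 2 (pp. 1185–1186)] [cite: MumfordAV1970, §19 Cor. 1–2] -/
theorem card_le_three_of_isIsogeny_fan_fermat_coprimeSix (hN2 : Nat.Coprime 2 N) (hN3 : Nat.Coprime 3 N)
    (hr : r ≠ 0) (hs : s ≠ 0) (ht : t ≠ 0) (hrst : r + s + t = 0)
    (hprim : ∀ q : ℕ, q.Prime → q ∣ N → ¬(q ∣ r.val ∧ q ∣ s.val ∧ q ∣ t.val))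
    (hA : IsCMTypeRealisation (cmTypeOfResidues (L := L) (fermatCMType N r s t) hS) A ι θ)
    {P B : AbelianVariety ℂ} {h : ℕ} {π : Fin h → (P ⟶ B)} (hP : IsLimit (Fan.mk P π)) {g : A ⟶ P} (hg : IsIsogeny g)
    (hsB : B.IsSimple) : 0 < h ∧ h ≤ 3 ∧ 2 * h * B.dim = N.totient := by
  haveI : IsCMField L := IsCyclotomicExtension.Rat.isCMField L (S := {N}) ⟨N, rfl, two_lt_level_sf hN2 hr⟩
  have hcard := card_eq_card_stabilizerResidues_of_isIsogeny_fan (N := N) hA hP hg hsB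
  refine ⟨card_pos_of_isIsogeny_fan ⟨hP⟩ hg hA.dim_pos, ?_⟩
  refine ⟨?_, ?_⟩
  · rw [hcard, residueSet_cmTypeOfResidues N (isCMResidueSet_fermatCMType hS)]
    exact card_stabilizerResidues_fermatCMType_le_three_coprimeSix hN2 hN3 hr hs ht hrst hprim
  · have e := dim_eq_card_mul_dim_of_isIsogeny_fan ⟨hP⟩ hg
    have hd := dim_eq_of_realisation (N := N) hA
    have htot : N.totient = 2 * (N.totient / 2) := by
      have h2 : 2 ∣ N.totient := even_iff_two_dvd.mp (Nat.totient_even (two_lt_level_sf hN2 hr))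
      omega
    rw [htot, ← hd, e]
    ring

end Count

/-! ## §5 `N = 91`: two classes of first-family triples — non-isogenous `12`-dimensional simple factors of `J(F₉₁)` -/

section NinetyOne

/-- `16` is a cube root of unity modulo `91` with `16² = 74`, `1 + 16 + 74 = 0`, `16 ≠ 1`; and the triple `{1, 16, 74}` is NOT a unit (indeed
not any) multiple of `{1, 9, 81}` (kernel check over `ℤ/91`). [cite: KoblitzRohrlich1978, Theorem 1 (i) (p. 1185) and Theorem 2 (p. 1186)] -/
theorem firstFamily_ninetyOne_sixteen :
    ((1 : ZMod 91) + 16 + 16 ^ 2 = 0 ∧ (16 : ZMod 91) ≠ 1 ∧ (-1 - 16 : ZMod 91) = 74 ∧ (-1 - 9 : ZMod 91) = 81) ∧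
      ∀ u : ZMod 91, ({1, 16, -1 - 16} : Multiset (ZMod 91)) ≠ {u * 1, u * 9, u * (-1 - 9)} := by
  refine ⟨⟨by decide, by decide, by decide, by decide⟩, ?_⟩
  decide

variable {L : Type} [Field L] [NumberField L] [IsCyclotomicExtension {91} ℚ L]
  {A A' : AbelianVariety ℂ}
  {ι : 𝓞 L →+* End A} {θ : L →+* Module.End ℂ (complexBetti A.X 1)}
  {ι' : 𝓞 L →+* End A'} {θ' : L →+* Module.End ℂ (complexBetti A'.X 1)}

/-- **Two non-isogenous simple factors of dimension `12` in `J(F₉₁)`**: for realisations `A` of `Φ_{H_{1,9,81}}` and `A′` of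
`Φ_{H_{1,16,74}}` (both first-family types modulo `91 = 7·13`, so `A ∼ B³`, `A′ ∼ B′³` with `dim B = dim B′ = 12` by gen 41's
`exists_realisation_isIsogeny_cube_ninetyOne`) and ANY decompositions into powers of simples, `B ≁ B′` — the triples are inequivalent.
[cite: KoblitzRohrlich1978, Theorem 1 (ii) (p. 1185) and Theorem 2 (p. 1186)] -/
theorem not_isIsogenous_simpleFactors_ninetyOne (hS : IsCMResidueSet 91 (fermatCMType 91 1 9 (-1 - 9)))
    (hS' : IsCMResidueSet 91 (fermatCMType 91 1 16 (-1 - 16)))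
    (hA : IsCMTypeRealisation (cmTypeOfResidues (L := L) (fermatCMType 91 1 9 (-1 - 9)) hS.cm) A ι θ)
    (hA' : IsCMTypeRealisation (cmTypeOfResidues (L := L) (fermatCMType 91 1 16 (-1 - 16)) hS'.cm) A' ι' θ')
    {P P' B B' : AbelianVariety ℂ} {h h' : ℕ} {π : Fin h → (P ⟶ B)} (hP : IsLimit (Fan.mk P π))
    {π' : Fin h' → (P' ⟶ B')} (hP' : IsLimit (Fan.mk P' π')) {g : A ⟶ P} (hg : IsIsogeny g) {g' : A' ⟶ P'}
    (hg' : IsIsogeny g') (hsB : B.IsSimple) (hsB' : B'.IsSimple) : ¬IsIsogenous B B' :=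
  not_isIsogenous_simpleFactors_fermat_of_forall (N := 91) (by norm_num) (by norm_num) (by decide) (by decide) (by decide) (by decide)
    (by decide) (by decide) (by decide) (by decide) hS hS' hA hA' hP hP' hg hg' hsB hsB' firstFamily_ninetyOne_sixteen.2

/-- The residue-set hypotheses of `not_isIsogenous_simpleFactors_ninetyOne` hold, and both types are realised (by `36`-folds): the
statement is not vacuous. [cite: Shimura1998, §6.2 Thm. 3] [cite: KoblitzRohrlich1978, §1 (p. 1183)] -/
theorem exists_realisations_ninetyOne :
    IsCMResidueSet 91 (fermatCMType 91 1 9 (-1 - 9)) ∧ IsCMResidueSet 91 (fermatCMType 91 1 16 (-1 - 16)) ∧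
      (∃ (hS : IsCMResidueSet 91 (fermatCMType 91 1 9 (-1 - 9))) (A : AbelianVariety ℂ) (ι : 𝓞 L →+* End A)
          (θ : L →+* Module.End ℂ (complexBetti A.X 1)),
          IsCMTypeRealisation (cmTypeOfResidues (L := L) (fermatCMType 91 1 9 (-1 - 9)) hS.cm) A ι θ ∧ A.dim = 36) ∧
      (∃ (hS' : IsCMResidueSet 91 (fermatCMType 91 1 16 (-1 - 16))) (A' : AbelianVariety ℂ) (ι' : 𝓞 L →+* End A')
          (θ' : L →+* Module.End ℂ (complexBetti A'.X 1)),
          IsCMTypeRealisation (cmTypeOfResidues (L := L) (fermatCMType 91 1 16 (-1 - 16)) hS'.cm) A' ι' θ' ∧ A'.dim = 36) := by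
  have hS : IsCMResidueSet 91 (fermatCMType 91 1 9 (-1 - 9)) :=
    isCMResidueSet_fermatCMType_of_ne_zero (by decide) (by decide) (by decide) (by decide)
  have hS' : IsCMResidueSet 91 (fermatCMType 91 1 16 (-1 - 16)) :=
    isCMResidueSet_fermatCMType_of_ne_zero (by decide) (by decide) (by decide) (by decide)
  haveI : IsCMField L := IsCyclotomicExtension.Rat.isCMField L (S := {91}) ⟨91, rfl, by norm_num⟩
  have htot : Nat.totient 91 = 72 := by decide
  obtain ⟨A, ι, θ, hA⟩ := exists_isCMTypeRealisation (cmTypeOfResidues (L := L) (fermatCMType 91 1 9 (-1 - 9)) hS.cm)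
  obtain ⟨A', ι', θ', hA'⟩ := exists_isCMTypeRealisation (cmTypeOfResidues (L := L) (fermatCMType 91 1 16 (-1 - 16)) hS'.cm)
  exact ⟨hS, hS', ⟨hS, A, ι, θ, hA, by rw [dim_eq_of_realisation (N := 91) hA, htot]⟩,
    ⟨hS', A', ι', θ', hA', by rw [dim_eq_of_realisation (N := 91) hA', htot]⟩⟩

end NinetyOne

end CyclotomicFermatCMType

end Literature.AlgebraicGeometry.ComplexMultiplication
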